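import Summits.BirchSwinnertonDyer.Rank1Residual.Additive.RamifiedSevenGenusEtaOneReading
import HarnessLib

set_option autoImplicit false

/-!
# `𝒞₇` genus road (crux `EllipticUnitValueSevenOfGZK`, K7r), the (5)-unit programme (SUMMON GENUS-UNIT-A6), File E3b:
# THE `Λ`-SIDE STICKELBERGER READING OF THE TWIST EXPONENT — modulo `h_n = (1+T)^{7ⁿ} − 1`,
# `(Σ_g Y(g)·R_n(σ_g))·R_n(σ_b) ≡ x·Θm`, where `R_n(σ_a) = χ_D(a)ω(a)⁵·(1+T)^{r_n(a)}` is the `η₁`-reading of `σ_a`,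
# `Y` is (A6-1)'s exponent, `x` is LEMMA M's element and `Θm` the Stickelberger series of `ω⁴χ_D` (ONE THEOREM)

Cell bsd-cm, seat bsd-cm-k-ty1 g27 (literature-prover); SUMMON `wake/SUMMON-bsd-cm-k-ty1-20260830T2140Z.md` (planner g36,
D972) block (A6-3) = File E, THIRD brick, second half.  The companion, in `Λ/(h_n) = ℤ₇[Γ_n]`, of (A6-1)'s complex dictionary
`Σ_h y_h χ̄(h) = (N − Ψ̄(N))·(Σ_a ā Ψ(a)/m)·ψ(b)` (`RamifiedSevenGenusStickelbergerDictionary.sum_twistExponent_mul_inv`).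

★★ `GenusFrame.twistExponentSum_mul_reading_sub_mem`: for `b ∈ (ℤ/mₙ)ˣ`, `Y(g) = ((bg)⁻¹‾/7)·⌊N𝔞·(bg)⁻¹‾/mₙ⌋`, `(N𝔞/7) = 1`,
the reading `R_n` (hypothesis `hR`) and ANY `x, Θm ∈ Λ` satisfying LEMMA M's congruence `x ≡ N𝔞 − η₁(N𝔞)(1+T)^{r_n(N𝔞)}`
(`GenusDatum.x_spec n`) and Lang's congruence `|D|7^{n+1}·Θm ≡ stickelbergerLayer 7 |D| (ω⁴χ_D) rInv n`
(`OrientedGenusDatum.Θm_spec n`): `(Σ_g C(Y g)·R_n(ḡ))·R_n(b̄) − x·Θm ∈ (h_n)`.  Proof in `Λ/(h_n)`: `R_n` is a homomorphism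
`ρ` on `(ℤ/mₙ)ˣ` (E3a §1); `mₙ·Σ_g Y(g)ρ(g) = Σ_c (c̄/7)(N c̄ − (Nc)‾)·ρ(c⁻¹)ρ(b⁻¹)` (`g ↦ c = (bg)⁻¹`, E3a `natCast_level_mul_div`);
the `(Nc)‾`-half reindexed by `c ↦ N̄c` (`((N̄c)‾/7) = (c̄/7)` as `(N𝔞/7) = 1`) is `ρ(N̄)` times the `c̄`-half; the `c̄`-half is
`ρ(b⁻¹)·Σ_c (c̄/7)c̄·ρ(c⁻¹) = ρ(b⁻¹)·(Lang's layer)` (E3a `oddBranchSeven_reading`); `N − ρ(N̄) ≡ x`; cancel `C(mₙ)` (E3a §4).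

HONEST LABEL: ring bookkeeping; no definition, no named fact, no instance; nothing closes; stmt-BirchSwinnertonDyer-19945 OPEN;
K1ᵘ NOT proved (E4 = the module-side assembly ★★★/★★★★ remains); `X12.CMRamifiedSeven` NOT proved; no summit statement is
proved by this seat; BSD is claimed for no curve.

## References
* S. Lang, *Cyclotomic Fields I–II* (1990) Ch. 1 §2 (Stickelberger elements `Σ⟨a/N⟩σ_a⁻¹`), Ch. 10 §1 Thm 1.2, §2 (2)–(3)
  (PDF pp. 14–16, 167–168, 171) [Lang1990]; L. Washington, *Introduction to Cyclotomic Fields* (1997) §6.2, §7.2 Thm 7.10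
  [Washington1997]; T. Tsuji, J. Number Theory 78 (1999) §6 (p. 20) [Tsuji1999].
* Tree: E3a `RamifiedSevenGenusEtaOneReading.lean` (this seat), (A6-1) `RamifiedSevenGenusStickelbergerDictionary.lean` (the model).
-/

noncomputable section

open scoped NumberField
open PowerSeries IsDedekindDomain
open Literature.NumberTheory.EllipticCurves
open Literature.NumberTheory.EllipticCurves.IwasawaAlgebra
open Literature.NumberTheory.IwasawaTheory
open Literature.NumberTheory.IwasawaTheory.StickelbergerSeries
open Literature.NumberTheory.ComplexMultiplication.EllipticUnits
open NumberTheorySymbols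

namespace Summit.BirchSwinnertonDyer.Rank1Residual.Additive.GenusSeven

namespace GenusFrame

variable (F : GenusFrame)

/-! ## The twist exponent sum reads `x·Θm` modulo `h_n` -/

/-- ★★ **THE `Λ`-SIDE STICKELBERGER READING OF THE TWIST EXPONENT.**  At level `n`, for `b ∈ (ℤ/mₙ)ˣ`, the exponent
`Y(g) = ((bg)⁻¹‾/7)·⌊N𝔞·(bg)⁻¹‾/mₙ⌋` of (A6-1)/(A6-2), `(N𝔞/7) = 1`, the reading `R_n` (hypothesis `hR`), and ANY `x, Θm ∈ Λ`
satisfying LEMMA M's congruence `x ≡ N𝔞 − η₁(N𝔞)(1+T)^{r_n(N𝔞)}` and Lang's congruence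
`|D|7^{n+1}·Θm ≡ stickelbergerLayer 7 |D| (ω⁴χ_D) rInv n` modulo `h_n`:
`(Σ_g C(Y g)·R_n(ḡ))·R_n(b̄) − x·Θm ∈ (h_n)`.  Proof in `Λ/(h_n)`: `R_n` is a homomorphism `ρ` on `(ℤ/mₙ)ˣ` (§1);
`mₙ·Σ_g Y(g)ρ(g) = Σ_c (c̄/7)(N c̄ − (Nc)‾)·ρ(b⁻¹c⁻¹)` (`g ↦ c = (bg)⁻¹`); the second half reindexed by `c ↦ N̄c`
(`(N̄c‾/7) = (c̄/7)` as `(N/7) = 1`) is `ρ(N̄)` times the first; the first is `ρ(b)⁻¹·Σ_c (c̄/7)c̄·ρ(c)⁻¹ = ρ(b)⁻¹·(Lang's layer)`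
(§2 `oddBranchSeven_reading`); `N − ρ(N̄) ≡ x`; cancel `C(mₙ)`.
[cite: Lang1990, Ch. 1 §2 and Ch. 10 §2 (2)–(3) (PDF pp. 14–16, 171)] [cite: Washington1997, §6.2 and §7.2 Thm 7.10] [cite: Tsuji1999, §6 (p. 20)] -/
theorem twistExponentSum_mul_reading_sub_mem (n : ℕ) [NeZero (7 ^ (n + 1) * F.d)] (b : (ZMod (7 ^ (n + 1) * F.d))ˣ)
    (Y : (ZMod (7 ^ (n + 1) * F.d))ˣ → ℤ)
    (hY : ∀ g : (ZMod (7 ^ (n + 1) * F.d))ˣ,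
      Y g = J(((((b * g)⁻¹ : (ZMod (7 ^ (n + 1) * F.d))ˣ) : ZMod (7 ^ (n + 1) * F.d)).val : ℤ) | 7) *
        ((F.normA * (((b * g)⁻¹ : (ZMod (7 ^ (n + 1) * F.d))ˣ) : ZMod (7 ^ (n + 1) * F.d)).val /
          (7 ^ (n + 1) * F.d) : ℕ) : ℤ))
    (hK : J((F.normA : ℤ) | 7) = 1) (R : ℕ → IwasawaAlgebra 7)
    (hR : ∀ a : ℕ, R a = C (F.χD (a : ZMod F.d) * F.ω (a : ZMod 7) ^ 5) * (1 + X) ^ F.r n a)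
    {x Θm : IwasawaAlgebra 7}
    (hx : x - (C (F.normA : ℤ_[7]) - C F.etaOneNormA * (1 + X) ^ (F.r n F.normA)) ∈ Ideal.span {layerModulus 7 n})
    (hΘ : C ((F.d * 7 ^ (n + 1) : ℕ) : ℤ_[7]) * Θm - stickelbergerLayer 7 F.d F.oddBranchSeven F.rInv n ∈
      Ideal.span {layerModulus 7 n}) :
    (∑ g : (ZMod (7 ^ (n + 1) * F.d))ˣ, C (((Y g : ℤ) : ℤ_[7])) * R ((g : ZMod (7 ^ (n + 1) * F.d))).val) *
        R ((b : ZMod (7 ^ (n + 1) * F.d))).val - x * Θm ∈ Ideal.span {layerModulus 7 n} := by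
  haveI : Fact (Nat.Prime 7) := ⟨Nat.prime_seven⟩
  -- the quotient `Λ/(h_n)`
  set I : Ideal (IwasawaAlgebra 7) := Ideal.span {layerModulus 7 n} with hI
  set π : IwasawaAlgebra 7 →+* IwasawaAlgebra 7 ⧸ I := Ideal.Quotient.mk I with hπ
  have hπeq : ∀ {y z : IwasawaAlgebra 7}, y - z ∈ I → π y = π z := fun h => Ideal.Quotient.eq.mpr h
  have hN : F.normA.Coprime (7 ^ (n + 1) * F.d) :=
    Nat.Coprime.mul_right (Nat.Coprime.pow_right _ F.normA_coprime_seven) F.normA_coprime_d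
  -- `N̄`, the unit of `N𝔞` in `ℤ/mₙ`
  obtain ⟨Nu, hNu⟩ : ∃ Nu : (ZMod (7 ^ (n + 1) * F.d))ˣ, Nu = ZMod.unitOfCoprime F.normA hN := ⟨_, rfl⟩
  -- §1: the reading is a homomorphism `ρ : (ℤ/mₙ)ˣ → Λ/(h_n)`
  let ρ : (ZMod (7 ^ (n + 1) * F.d))ˣ →* IwasawaAlgebra 7 ⧸ I :=
    { toFun := fun g => π (R ((g : ZMod (7 ^ (n + 1) * F.d))).val)
      map_one' := by
        have h := hπeq (F.reading_units_one_sub_mem n R hR)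
        rwa [map_one] at h
      map_mul' := fun g g' => by
        have h := hπeq (F.reading_units_mul_sub_mem n R hR g g')
        rwa [map_mul] at h }
  have hρ : ∀ g : (ZMod (7 ^ (n + 1) * F.d))ˣ, π (R ((g : ZMod (7 ^ (n + 1) * F.d))).val) = ρ g := fun g => rfl
  have hρinv : ∀ g : (ZMod (7 ^ (n + 1) * F.d))ˣ, ρ g⁻¹ * ρ g = 1 := fun g => by
    rw [← map_mul, inv_mul_cancel, map_one]
  -- the Legendre character of the residues is `N̄`-invariant: `((N̄c)‾/7) = (N𝔞/7)(c̄/7) = (c̄/7)`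
  have hκN : ∀ c : (ZMod (7 ^ (n + 1) * F.d))ˣ,
      J((((Nu * c : (ZMod (7 ^ (n + 1) * F.d))ˣ) : ZMod (7 ^ (n + 1) * F.d)).val : ℤ) | 7) =
        J((((c : ZMod (7 ^ (n + 1) * F.d))).val : ℤ) | 7) := by
    intro c
    rw [F.jacobiSym_val_mul, hNu, F.jacobiSym_val_unitOfCoprime n hN, hK, one_mul]
  -- the summands after the reindexing `g ↦ c = (bg)⁻¹`
  -- `A c = C((c̄/7)·(N c̄ − (Nc)‾))`, `T c = C((c̄/7)·c̄)`
  obtain ⟨A, hA⟩ : ∃ A : (ZMod (7 ^ (n + 1) * F.d))ˣ → IwasawaAlgebra 7, ∀ c, A c =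
      C (((J((((c : ZMod (7 ^ (n + 1) * F.d))).val : ℤ) | 7) *
        ((F.normA : ℤ) * ((((c : ZMod (7 ^ (n + 1) * F.d))).val : ℕ) : ℤ) -
          ((((Nu * c : (ZMod (7 ^ (n + 1) * F.d))ˣ) : ZMod (7 ^ (n + 1) * F.d)).val : ℕ) : ℤ)) : ℤ) : ℤ_[7])) :=
    ⟨_, fun c => rfl⟩
  obtain ⟨T, hT⟩ : ∃ T : (ZMod (7 ^ (n + 1) * F.d))ˣ → IwasawaAlgebra 7, ∀ c, T c =
      C (((J((((c : ZMod (7 ^ (n + 1) * F.d))).val : ℤ) | 7) : ℤ) : ℤ_[7]) *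
        ((((c : ZMod (7 ^ (n + 1) * F.d))).val : ℕ) : ℤ_[7])) :=
    ⟨_, fun c => rfl⟩
  -- Step 1: `C(mₙ)·Σ_g C(Y g)ρ(g) = Σ_g A((bg)⁻¹)·ρ(((bg)⁻¹)⁻¹)·ρ(b⁻¹)`  (`mₙ⌊N c̄/mₙ⌋ = N c̄ − (Nc)‾`, `g = ((bg)⁻¹)⁻¹b⁻¹`)
  have step1 : π (C (((7 ^ (n + 1) * F.d : ℕ) : ℤ_[7]))) *
      π (∑ g : (ZMod (7 ^ (n + 1) * F.d))ˣ, C (((Y g : ℤ) : ℤ_[7])) * R ((g : ZMod (7 ^ (n + 1) * F.d))).val) =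
      ∑ g : (ZMod (7 ^ (n + 1) * F.d))ˣ, π (A (b * g)⁻¹) * ρ ((b * g)⁻¹)⁻¹ * ρ b⁻¹ := by
    rw [map_sum, Finset.mul_sum]
    refine Finset.sum_congr rfl fun g _ => ?_
    have hg : ρ g = ρ ((b * g)⁻¹)⁻¹ * ρ b⁻¹ := by rw [← map_mul, inv_inv, mul_inv_cancel_comm]
    have hmYℤ : ((7 ^ (n + 1) * F.d : ℕ) : ℤ) * Y g =
        J(((((b * g)⁻¹ : (ZMod (7 ^ (n + 1) * F.d))ˣ) : ZMod (7 ^ (n + 1) * F.d)).val : ℤ) | 7) *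
          ((F.normA : ℤ) * (((((b * g)⁻¹ : (ZMod (7 ^ (n + 1) * F.d))ˣ) : ZMod (7 ^ (n + 1) * F.d)).val : ℕ) : ℤ) -
            ((((Nu * (b * g)⁻¹ : (ZMod (7 ^ (n + 1) * F.d))ˣ) : ZMod (7 ^ (n + 1) * F.d)).val : ℕ) : ℤ)) := by
      rw [hY g, mul_left_comm, F.natCast_level_mul_div n hN, hNu]
    have hmY : C (((7 ^ (n + 1) * F.d : ℕ) : ℤ_[7])) * C (((Y g : ℤ) : ℤ_[7])) = A (b * g)⁻¹ := by
      rw [hA, ← map_mul, ← Int.cast_natCast, ← Int.cast_mul, hmYℤ]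
    rw [map_mul π, ← mul_assoc, ← map_mul π, hmY, hρ, hg, mul_assoc]
  -- Step 2: reindex `g ↦ c = (bg)⁻¹`
  have step2 : (∑ g : (ZMod (7 ^ (n + 1) * F.d))ˣ, π (A (b * g)⁻¹) * ρ ((b * g)⁻¹)⁻¹ * ρ b⁻¹) =
      ∑ c : (ZMod (7 ^ (n + 1) * F.d))ˣ, π (A c) * ρ c⁻¹ * ρ b⁻¹ :=
    Fintype.sum_equiv ((Equiv.mulLeft b).trans (Equiv.inv _)) _ _ (fun g => rfl)
  -- Step 3: `A c = N·T c − T(N̄c)` (as `(N̄c‾/7) = (c̄/7)`), and the `T(N̄c)`-half reindexed by `c ↦ N̄c` is `ρ(N̄)` times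
  -- the `T`-sum: `Σ_c A c ρ(c⁻¹) ρ(b⁻¹) = (C N − ρ N̄)·ρ(b⁻¹)·Σ_c T c ρ(c⁻¹)`
  have hsplit : ∀ c : (ZMod (7 ^ (n + 1) * F.d))ˣ,
      π (A c) * ρ c⁻¹ * ρ b⁻¹ =
        π (C (F.normA : ℤ_[7])) * ρ b⁻¹ * (π (T c) * ρ c⁻¹) - ρ b⁻¹ * (π (T (Nu * c)) * ρ c⁻¹) := by
    intro c
    rw [hA, hT, hT, hκN c]
    push_cast
    simp only [map_mul, map_sub]
    ring
  have hinv : ∀ c : (ZMod (7 ^ (n + 1) * F.d))ˣ, ρ c⁻¹ = ρ Nu * ρ (Nu * c)⁻¹ := fun c => by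
    rw [← map_mul, mul_inv_rev, ← mul_assoc, mul_inv_cancel_comm]
  have hre : (∑ c : (ZMod (7 ^ (n + 1) * F.d))ˣ, π (T (Nu * c)) * ρ c⁻¹) =
      ρ Nu * ∑ c : (ZMod (7 ^ (n + 1) * F.d))ˣ, π (T c) * ρ c⁻¹ := by
    rw [Finset.mul_sum]
    refine Fintype.sum_equiv (Equiv.mulLeft Nu) _ _ fun c => ?_
    rw [Equiv.coe_mulLeft, hinv c]
    ring
  have step3 : (∑ c : (ZMod (7 ^ (n + 1) * F.d))ˣ, π (A c) * ρ c⁻¹ * ρ b⁻¹) =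
      (π (C (F.normA : ℤ_[7])) - ρ Nu) * ρ b⁻¹ * ∑ c : (ZMod (7 ^ (n + 1) * F.d))ˣ, π (T c) * ρ c⁻¹ := by
    rw [Finset.sum_congr rfl (fun c _ => hsplit c), Finset.sum_sub_distrib, ← Finset.mul_sum, ← Finset.mul_sum, hre]
    ring
  -- Step 4: the `T`-sum is Lang's layer: `T c·ρ(c⁻¹) = π(C(ψ(c̄)c̄)(1+T)^{rInv_n(c̄)})` (§2 `oddBranchSeven_reading`)
  have step4 : (∑ c : (ZMod (7 ^ (n + 1) * F.d))ˣ, π (T c) * ρ c⁻¹) =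
      π (stickelbergerLayer 7 F.d F.oddBranchSeven F.rInv n) := by
    rw [F.stickelbergerLayer_eq_sum_units n, map_sum]
    refine Finset.sum_congr rfl fun c _ => ?_
    have hterm := hπeq (F.oddBranchSeven_reading n R hR (F.val_coprime_d_mul_seven n c))
    rw [map_mul π, hρ, ← hT] at hterm
    calc π (T c) * ρ c⁻¹
        = π (C (F.oddBranchSeven ((((c : ZMod (7 ^ (n + 1) * F.d))).val : ℕ) : ZMod (F.d * 7)) *
              ((((c : ZMod (7 ^ (n + 1) * F.d))).val : ℕ) : ℤ_[7])) *
            (1 + X) ^ F.rInv n ((c : ZMod (7 ^ (n + 1) * F.d))).val) * (ρ c⁻¹ * ρ c) := by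
          rw [← hterm]; ring
      _ = _ := by rw [hρinv c, mul_one]
  -- Step 5: `π x = C N − ρ(N̄)` (LEMMA M's congruence; `R_n(N𝔞) ≡ R_n(N𝔞 mod mₙ) = ρ N̄`) and `C(mₙ)·π Θm = π(layer)`
  have step5x : π x = π (C (F.normA : ℤ_[7])) - ρ Nu := by
    have h1 := hπeq hx
    rw [map_sub] at h1
    rw [h1]
    congr 1
    have hRN : C F.etaOneNormA * (1 + X) ^ (F.r n F.normA) = R F.normA := by rw [hR, F.etaOneNormA_def]
    rw [hRN, ← hρ, hNu, ZMod.coe_unitOfCoprime, ZMod.val_natCast]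
    exact (hπeq (F.reading_mod_sub_mem n R hR F.normA_coprime_seven)).symm
  have step5Θ : π (C (((7 ^ (n + 1) * F.d : ℕ) : ℤ_[7]))) * π Θm =
      π (stickelbergerLayer 7 F.d F.oddBranchSeven F.rInv n) := by
    rw [← map_mul, show 7 ^ (n + 1) * F.d = F.d * 7 ^ (n + 1) from Nat.mul_comm _ _]
    exact hπeq hΘ
  -- assembly in `Λ/(h_n)`, then cancel `C(mₙ)`
  have key : π (C (((7 ^ (n + 1) * F.d : ℕ) : ℤ_[7])) *
      ((∑ g : (ZMod (7 ^ (n + 1) * F.d))ˣ, C (((Y g : ℤ) : ℤ_[7])) * R ((g : ZMod (7 ^ (n + 1) * F.d))).val) *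
        R ((b : ZMod (7 ^ (n + 1) * F.d))).val - x * Θm)) = 0 := by
    rw [map_mul π, map_sub, map_mul π, map_mul π, hρ b, mul_sub, ← mul_assoc, step1, step2, step3, step4, step5x]
    calc (π (C (F.normA : ℤ_[7])) - ρ Nu) * ρ b⁻¹ * π (stickelbergerLayer 7 F.d F.oddBranchSeven F.rInv n) * ρ b -
          π (C (((7 ^ (n + 1) * F.d : ℕ) : ℤ_[7]))) * ((π (C (F.normA : ℤ_[7])) - ρ Nu) * π Θm)
        = (π (C (F.normA : ℤ_[7])) - ρ Nu) * (ρ b⁻¹ * ρ b) * π (stickelbergerLayer 7 F.d F.oddBranchSeven F.rInv n) -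
            (π (C (F.normA : ℤ_[7])) - ρ Nu) * (π (C (((7 ^ (n + 1) * F.d : ℕ) : ℤ_[7]))) * π Θm) := by ring
      _ = 0 := by rw [hρinv b, mul_one, step5Θ, sub_self]
  rw [Ideal.Quotient.eq_zero_iff_mem] at key
  exact F.mem_span_layerModulus_of_C_level_mul_mem n key

end GenusFrame

end Summit.BirchSwinnertonDyer.Rank1Residual.Additive.GenusSeven

end
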